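import Literature.NumberTheory.EllipticCurves.XZeroThirtyTwoEtaQuotientUnits
import Literature.NumberTheory.EllipticCurves.TianYuanZhang2017.CMPointSevenBlockValueDisplays
import HarnessLib

/-!
# Yang's `η`-quotient coordinates of `X₀(32) ≅ 32A1 : y² = x³ + 4x` — `x = η(16τ)⁶/(η(8τ)²η(32τ)⁴)`,
# `y = ±η(8τ)⁴η(16τ)²/(η(4τ)²η(32τ)⁴)` along every degree-`1` modular parametrisation (DISPLAY: one named fact)

Topic `Literature/NumberTheory/EllipticCurves`; namespace `Literature.NumberTheory.EllipticCurves.ModularForms` (sequel of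
`XZeroThirtyTwoEtaQuotientUnits`, cell typer ty2 g47, which PROVED that the three `η`-quotients `x_η = etaQuotient 32 rX`,
`(x²+4)_η`, `y_η = etaQuotient 32 rY` are modular units on `X₀(32)` with Ligozat's cusp orders, and recorded: «NOT proved here: the
IDENTITIES `x ∘ φ = x_η`, `y ∘ φ = ±y_η` with the modular parametrisation `φ` … Ligozat does not print them (his coordinates for
`N = 32` come from Fricke's functions `σ, τ` of §4.1)»).  THE PRINT EXISTS: Yifan Yang, *Defining equations of modular curves*, Adv.
Math. 204 (2006), §4.1, Table «Equations for `X₀(N)`», row `N = 32` (p. 504): **`X = 16⁶/(8²·32⁴)`, `Y = 8⁴16²/(4²32⁴)`** (Yang's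
abbreviation `∏ aᵢ^{bᵢ}` for `∏ η(aᵢτ)^{bᵢ}`), **equation `Y² = X³ + 4X`** — with the standing conventions of §4.1 («we choose functions `X`
and `Y` with leading Fourier coefficients `1`»; «Whenever the genus of `X₀(N)` is `1`, we adjust the choice of `X` and `Y` so that the
equation is in agreement with Cremona's table», p. 503) and the method of §3 (Lemma 2: `X`, `Y` are modular functions on `X₀(N)` with
poles only at `∞`, of orders `2` and `3` when the genus is `1`, generating the function field).  In words: **`τ ↦ (X(τ), Y(τ))` is an
isomorphism `(X₀(32), ∞) ⥲ (A, O)` defined over `ℚ`**, `A = 32A1 : y² = x³ + 4x` (the tree's `TianYuanZhang2017.curveA = ⟨0,0,0,4,0⟩`;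
Ligozat's minimal equation of `X₀(32)`, table (4.2.6)).  (Arithmetic check of the row, recorded by the LEAD of crux
stmt-BirchSwinnertonDyer-20509, g32: with `X = q⁻² + 2q⁶ − …`, `Y = q⁻³ + 2q + q⁵ + …` the `q`-expansion of `Y² − X³ − 4X` vanishes to
`O(q⁵⁷)`; exact integer arithmetic.)

THE TREE'S READING (one named fact, `x032_φ_eq_etaQuotient`).  A `ModularParametrizationData curveA 32` (`ModularCurve.lean`) is a
parametrisation `φ_D(τ) = uniformize_Λ(c·2πi∫_{i∞}^τ f)` of the MODEL `curveA` by `X₀(32)` (`f` the newform of `A`, i.e. `η(4τ)²η(8τ)²`,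
Ligozat table (3.1.2); `Λ` the Néron lattice of the model; `c ∈ ℤ` its Manin constant; `D.modularDegree` its degree).  If
`D.modularDegree = 1`, the induced map `φ̄_D : X₀(32) → A` is birational, hence an isomorphism of smooth projective curves with `∞ ↦ O`,
and it is defined over `ℝ` (`c ∈ ℤ`, `f` has real coefficients, `Λ̄ = Λ`); so `φ̄_D ∘ (X,Y)⁻¹ ∈ Aut(A, O) = {±1, ±[i]}` is defined over `ℝ`,
i.e. `φ̄_D = ±(X, Y)`, and `x ∘ φ_D = X`, `y ∘ φ_D = ±Y` exactly.  The fact below displays precisely this: for every degree-`1` datum and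
every `τ ∈ ℍ`, `φ_D(τ)` is the AFFINE point (`τ ∈ ℍ` is not the cusp `∞`) with `x = x_η(τ) = etaQuotient 32 rX τ` and
`y = ±y_η(τ) = ±etaQuotient 32 rY τ`.  This is the level-`32` twin of the tree's `x049_x_sub_two_eq_etaQuotient` (`X049EtaDescent.lean`,
Ligozat's `x − 2 = η(τ)/η(49τ)` on `X₀(49)`, stated there for data with `|c| = 1`); here the degree-`1` guard is used because it is the
currency of the consumer (`TianYuanZhang2017.SevenBlockCMValue`, (S4): «`z_d = i₀(P_d)` for a degree-`1` datum», p810361) and because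
«degree `1` ⟹ `±(X,Y)`» needs no statement about the Manin constant.

WHY (consumer).  THEOREM A of the LEAD lineage of crux stmt-BirchSwinnertonDyer-20509 (skeleton v11, stub `stub_offTYZ_firstNormSquare_R2`;
memo `Cruxes/RamifiedOffTYZOfFacts/Lines/offtyz_v7_ExactDescent.md` §2): the first `2`-descent coordinate of the genus period is the class
of `N_{H/L} x(z_n)`, `z_n = i₀(P_n)`; with (S4) and THIS fact, `x(z_n) = x_η(τ_n) = s(τ_n)²` for the `η`-quotient `s = etaQuotient 32 rS` of
character `(2/·)` (`XZeroThirtyTwoEtaQuotientSqrtXProofs`: `etaQuotient_rX_eq_sq`, `etaQuotient_rS_smul`), whose CM values Shimura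
reciprocity controls (`ComplexMultiplication/ShimuraReciprocityExtendedRingClass.lean`).  This was the ONE non-typed input of THEOREM A's
road (ty2 g51 HANDOFF: «separate PROOF target: `x(Dt.φ τ) = (etaQuotient 32 rS τ)²`»); it is PRINT (Yang 2006), so it is displayed, not
proved.

HONEST FRAMING: statements only (`def … : Prop`, nothing asserted, no `_holds` expected — a `q`-expansion/Riemann–Roch identity on the
genus-`1` curve `X₀(32)` that Mathlib cannot yet phrase as a proof); net debt +2 (rev 2 appends `x032_φ_injective`, the injectivity half of
«`(X,Y)` is an isomorphism»); consumers take `(h : x032_φ_eq_etaQuotient)` / `(h : x032_φ_injective)` as explicit hypotheses.  NOT displayed: the sign of `y ∘ φ_D` as a function of `D` (it is `sign(c)·(orientation)`); the other rows of Yang's table;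
`(x²+4)_η`.  Cell `bsd-print-cf2`, LEAD seat cruxlead-20509 g32.  BSD is not proved by any of this; no class is closed by this file.

References: [Yang2006DefiningEquations] Y. Yang, *Defining equations of modular curves*, Adv. Math. 204 (2006) 481–508, §3 Lemma 2, §4.1
(p. 502–504, Table, row `N = 32`) (held text `paper:doi-10-1016-j-aim-2005-05-019`, p0022–p0024); [Ligozat1975] G. Ligozat, *Courbes modulaires
de genre 1*, Mém. SMF 43 (1975), table (3.1.2) (`N = 32`: `f = η(4z)²η(8z)²`), Prop. 3.2.1, table (4.2.6) (`X₀(32)`: `y² = x³ + 4x`);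
[EdixhovenManin1991] §1 (the parametrisation `X₀(N) → E`, `∞ ↦ O`).
-/

noncomputable section

open UpperHalfPlane hiding I
open scoped MatrixGroups

namespace Literature.NumberTheory.EllipticCurves.ModularForms

open Literature.NumberTheory.EllipticCurves.TianYuanZhang2017 (curveA)

/-- **Yang 2006, §4.1 Table, row `N = 32` (with Ligozat 1975 (4.2.6)), read on the tree's modular parametrisation data**: for every
modular parametrisation datum `D` of `A = curveA : y² = x³ + 4x` by `X₀(32)` of modular degree `1` (so `φ̄_D : (X₀(32), ∞) ⥲ (A, O)` is
`±` Yang's isomorphism `(X, Y)`) and every `τ` in the upper half plane, `φ_D(τ)` is the affine point of `A(ℂ)` with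
`x`-coordinate `X(τ) = η(16τ)⁶/(η(8τ)²η(32τ)⁴) = etaQuotient 32 rX τ` and `y`-coordinate `±Y(τ)`, `Y = η(8τ)⁴η(16τ)²/(η(4τ)²η(32τ)⁴) =
etaQuotient 32 rY τ`.  Nothing asserted; no `_holds` expected.
[cite: Yang2006DefiningEquations, §4.1 Table (Equations for X₀(N)), row N = 32, with §3 Lemma 2 and p. 503]
[cite: Ligozat1975, table (4.2.6) (X₀(32): y² = x³ + 4x) and table (3.1.2) (N = 32)] [cite: EdixhovenManin1991, §1] -/
def x032_φ_eq_etaQuotient : Prop :=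
  ∀ (D : ModularParametrizationData curveA 32), D.modularDegree = 1 → ∀ τ : ℍ,
    ∃ (yτ : ℂ) (h : (curveA.baseChange ℂ).toAffine.Nonsingular (etaQuotient 32 rX τ) yτ),
      D.φ τ = .some (etaQuotient 32 rX τ) yτ h ∧ (yτ = etaQuotient 32 rY τ ∨ yτ = -etaQuotient 32 rY τ)

/-- **Yang 2006, §4.1 Table, row `N = 32` — the other half of «`(X, Y)` is an isomorphism `X₀(32) ⥲ A`»: INJECTIVITY on
`Y₀(32) = Γ₀(32)\ℍ`.**  `X = etaQuotient 32 rX` and `Y = etaQuotient 32 rY` generate the function field of `X₀(32)` (Yang §3, Lemma 2 and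
§4.1: poles only at `∞`, of coprime orders `2`, `3`), so `τ ↦ (X(τ), Y(τ))` is a birational map, hence an ISOMORPHISM, of the smooth projective
curve `X₀(32)` onto `A : y² = x³ + 4x`; in particular two points of the upper half plane with the same image are `Γ₀(32)`-equivalent.  Read on
the tree's data as in `x032_φ_eq_etaQuotient` (a degree-`1` datum is `±(X, Y)`): for every modular parametrisation datum `D` of `curveA` at
level `32` of modular degree `1`, `D.φ τ = D.φ τ'` implies `τ' = γ • τ` for some `γ ∈ Γ₀(32)`.  (Used by the consumer to see that the `g(n)`
Galois conjugates of TYZ's CM point `z_n = i₀(P_n)` over `L_n(i)` are pairwise distinct: distinct Heegner points of level `32` have distinct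
images.)  Nothing asserted; no `_holds` expected (degree-`1` ⟹ bijective needs the fibre count of `deg_spec` at EVERY point, i.e. Zariski's
main theorem / smoothness of `X₀(32)`, not available to the kernel).
[cite: Yang2006DefiningEquations, §3 Lemma 2 and §4.1 Table (Equations for X₀(N)), row N = 32]
[cite: Ligozat1975, Cor. of Lemma 4.1.1 (F_N is a model of X_N over ℚ) and table (4.2.6)] [cite: EdixhovenManin1991, §1] -/
def x032_φ_injective : Prop :=
  ∀ (D : ModularParametrizationData curveA 32), D.modularDegree = 1 → ∀ τ τ' : ℍ,
    D.φ τ = D.φ τ' → ∃ γ : SL(2, ℤ), γ ∈ CongruenceSubgroup.Gamma0 32 ∧ τ' = γ • τ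

end Literature.NumberTheory.EllipticCurves.ModularForms

end
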